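/-
Copyright: the b2b-balaban T⁴-continuum CRUX team, row NE7b leaf lineage `t4-ne7b-formalise-leaf-05` (gen 157). Project licence.
-/
import Mathlib.Analysis.InnerProductSpace.PiL2
import Mathlib.LinearAlgebra.Matrix.DotProduct

/-!
# THE COORDINATE BRIDGE OF THE (h2) SLOT: a floor `c·Σ_c‖x c‖² ≤ F x` on bond fields `x : C → W` (`W` a finite-dimensional REAL INNER-PRODUCT space — print's
# Hilbert–Schmidt 𝔲(n), or `M_n(ℂ)` with the Frobenius inner product) IS the hypothesis `h2 : ∀ B, good B → c·(B ⬝ᵥ B) ≤ F B` of `B9SectEKernel.gamma0_assembly`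
# on the real coordinates `B : C × κ → ℝ` of an orthonormal basis — Parseval, and the two readings determine each other (row NE7b, node U5c; residual (R2′)
# family (2), letter (ℓ1); junction lemma)

Cell `pub-balaban`, sub-cell `t4`, spine estimate NE7b (`T4WeightBudget.RelWeightBound`; the cell's OWN estimate — NOT PRINTED in [Bałaban 1983–89],
NOT PROVED).  Crux-route work under `Spine/NE7b/`; NOTHING of Bałaban's is asserted; no `def`; zero `sorry`; no `T4Continuum/Support` leaf (FREEZE (0)).
Imports: Mathlib only (`InnerProductSpace.PiL2`: `OrthonormalBasis.repr`, `EuclideanSpace.real_norm_sq_eq`; `Matrix.DotProduct`).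

WHY.  The (h2) files of this lineage end in two currencies of the SAME floor: AFST ∕ AFLP conclude `c·Σ_c‖x c‖² ≤ F x` for `x : C → W` (any real normed `W`),
while `B9SectEKernel.gamma0_assembly` (the kernel theorem behind print's `γ₀`) wants `h2 : ∀ B : m → ℝ, good B → c·(B ⬝ᵥ B) ≤ F B` on REAL COORDINATES.  When `W`
is an inner-product space (print's `|·|` on 𝔤 IS Hilbert–Schmidt, [B7] (17); the tree: `T4AdjointCovarianceUnitary`'s `lieU n`, or `M_n(ℂ)` under
`QuantumLattice.frobeniusInnerProductSpace`) an orthonormal basis `b : OrthonormalBasis κ ℝ W` makes the two the same statement with `m := C × κ`: THIS FILE is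
that bridge (answer A-leaf05-g157-1's «HS route»; memo `H2-CURRENCY-JUNCTION-g157.md` §2 last row).  It is NOT the (R2) junction itself (the E-side's (h1) must be
read on the same coordinates — the OWNER's), only its (h2) half.

WHAT IS PROVED ([folklore]; `b : OrthonormalBasis κ ℝ W`; coordinates `fun p : C × κ => b.repr (x p.1) p.2`, reconstruction
`fun v c => b.repr.symm (toLp 2 fun a => v (c, a))` — written out, no `def`):
* §1 `sum_normSq_eq_dotProduct_coords` (PARSEVAL: `Σ_c ‖x c‖² = X ⬝ᵥ X` for the coordinate vector `X`), `recon_coords` ∕ `coords_recon` (the two maps are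
  inverse), `sum_normSq_recon` (`Σ_c ‖(recon v) c‖² = v ⬝ᵥ v`).
* §2 **`h2_of_normSq_floor`** — a floor `∀ x, good x → c·Σ_c‖x c‖² ≤ F x` on `C → W` gives, for `F̃ v := F (recon v)` and `good̃ v := good (recon v)`,
  `∀ v : C × κ → ℝ, good̃ v → c·(v ⬝ᵥ v) ≤ F̃ v` — VERBATIM the `h2` of `gamma0_assembly` on `m = C × κ`; **`normSq_floor_of_h2`** — the converse reading.
* §3 toy: `W = EuclideanSpace ℝ (Fin 1)` with its standard basis, `C = Unit`: Parseval by §1 (`example`).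

NOT HERE (honest): the (h1) side on the same coordinates, the choice of `W` ∕ basis for the row (Q-leaf05-g157-1, OWNER), anything of Bałaban's.
BY-NAME EFFECT ON THE WALL: NONE.  NE7b NOT PRINTED ∕ NOT PROVED; spine PROVED 0∕9; rung (B)+1 on ONE finite T⁴ — NOT infinite volume, NOT the mass gap, NOT Clay.
HONEST DEPENDENCY: continuum YM on T⁴ ⇐ BetaPertH ∧ nine spine estimates (0/9 proved); BetaPertH ⇐ (D1) ∧ (D4) ∧ CAP+tail; G-an2-4 gates asym, D1 and NE2/3/4.
-/

set_option autoImplicit false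

noncomputable section

open Finset Matrix WithLp

namespace Summit.QuantumFields.BalabanUV.T4Continuum.NE7b.AdmissibleFloorCoordinates

variable {C κ W : Type*} [Fintype C] [Fintype κ]
variable [NormedAddCommGroup W] [InnerProductSpace ℝ W]

/-! ## §1 Parseval on bond fields, and the coordinate ∕ reconstruction maps are inverse -/

/-- **PARSEVAL ON BOND FIELDS**: `Σ_c ‖x c‖² = X ⬝ᵥ X` for the coordinate vector `X(c, a) = (b.repr (x c)) a` of an orthonormal basis `b`. [folklore] -/
theorem sum_normSq_eq_dotProduct_coords (b : OrthonormalBasis κ ℝ W) (x : C → W) :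
    ∑ c, ‖x c‖ ^ 2 = (fun p : C × κ => b.repr (x p.1) p.2) ⬝ᵥ (fun p : C × κ => b.repr (x p.1) p.2) := by
  simp only [dotProduct]
  rw [Fintype.sum_prod_type]
  refine Finset.sum_congr rfl fun c _ => ?_
  rw [← b.repr.norm_map (x c), EuclideanSpace.real_norm_sq_eq]
  exact Finset.sum_congr rfl fun a _ => by ring

omit [Fintype C] in
/-- reconstruction after coordinates is the identity. [folklore] -/
theorem recon_coords (b : OrthonormalBasis κ ℝ W) (x : C → W) :
    (fun c => b.repr.symm (toLp 2 fun a => (fun p : C × κ => b.repr (x p.1) p.2) (c, a))) = x := by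
  funext c
  have h : (toLp 2 fun a => b.repr (x c) a : EuclideanSpace ℝ κ) = b.repr (x c) := by
    ext a; rfl
  rw [h, LinearIsometryEquiv.symm_apply_apply]

omit [Fintype C] in
/-- coordinates after reconstruction is the identity. [folklore] -/
theorem coords_recon (b : OrthonormalBasis κ ℝ W) (v : C × κ → ℝ) :
    (fun p : C × κ => b.repr ((fun c => b.repr.symm (toLp 2 fun a => v (c, a))) p.1) p.2) = v := by
  funext p
  simp only [LinearIsometryEquiv.apply_symm_apply, PiLp.toLp_apply]

/-- `Σ_c ‖(recon v) c‖² = v ⬝ᵥ v`. [folklore] -/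
theorem sum_normSq_recon (b : OrthonormalBasis κ ℝ W) (v : C × κ → ℝ) :
    ∑ c, ‖(fun c => b.repr.symm (toLp 2 fun a => v (c, a))) c‖ ^ 2 = v ⬝ᵥ v := by
  have h := sum_normSq_eq_dotProduct_coords b (fun c => b.repr.symm (toLp 2 fun a => v (c, a)))
  rw [coords_recon b v] at h
  exact h

/-! ## §2 The floor in the two currencies -/

/-- **THE (h2) HYPOTHESIS OF `gamma0_assembly` FROM A HILBERT–SCHMIDT FLOOR ON BOND FIELDS**: `∀ x, good x → c·Σ_c‖x c‖² ≤ F x` on `C → W` gives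
`∀ v, good (recon v) → c·(v ⬝ᵥ v) ≤ F (recon v)` on the real coordinates `C × κ → ℝ` — VERBATIM `h2` with `F̃ := F ∘ recon`, `good̃ := good ∘ recon`. [folklore] -/
theorem h2_of_normSq_floor (b : OrthonormalBasis κ ℝ W) (F : (C → W) → ℝ) (good : (C → W) → Prop) {c : ℝ}
    (hfloor : ∀ x : C → W, good x → c * ∑ c', ‖x c'‖ ^ 2 ≤ F x) :
    ∀ v : C × κ → ℝ, good (fun c' => b.repr.symm (toLp 2 fun a => v (c', a))) →
      c * (v ⬝ᵥ v) ≤ F (fun c' => b.repr.symm (toLp 2 fun a => v (c', a))) := by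
  intro v hv
  rw [← sum_normSq_recon b v]
  exact hfloor _ hv

/-- **THE CONVERSE READING**: an `h2`-floor on the coordinates gives the Hilbert–Schmidt floor on bond fields. [folklore] -/
theorem normSq_floor_of_h2 (b : OrthonormalBasis κ ℝ W) (F : (C → W) → ℝ) (good : (C → W) → Prop) {c : ℝ}
    (h2 : ∀ v : C × κ → ℝ, good (fun c' => b.repr.symm (toLp 2 fun a => v (c', a))) →
      c * (v ⬝ᵥ v) ≤ F (fun c' => b.repr.symm (toLp 2 fun a => v (c', a)))) :
    ∀ x : C → W, good x → c * ∑ c', ‖x c'‖ ^ 2 ≤ F x := by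
  intro x hx
  have h := h2 (fun p : C × κ => b.repr (x p.1) p.2)
  rw [recon_coords b x] at h
  rw [sum_normSq_eq_dotProduct_coords b x]
  exact h hx

/-! ## §3 Toy: one bond, `W = ℝ¹` -/

example (x : Unit → EuclideanSpace ℝ (Fin 1)) :
    ∑ c, ‖x c‖ ^ 2 = (fun p : Unit × Fin 1 => (EuclideanSpace.basisFun (Fin 1) ℝ).repr (x p.1) p.2)
      ⬝ᵥ (fun p : Unit × Fin 1 => (EuclideanSpace.basisFun (Fin 1) ℝ).repr (x p.1) p.2) :=
  sum_normSq_eq_dotProduct_coords _ x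

end Summit.QuantumFields.BalabanUV.T4Continuum.NE7b.AdmissibleFloorCoordinates

end
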